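import Summits.Ventures.Crystal3D.Theorems.StickyWulffConstantCoaxialWallLawBarlowSiteReadings
import HarnessLib

/-!
# The MIRROR dozen also reads at the fault layers of a Barlow site (F_layer L2/L3 brick, part 2)

HONEST FRAMING. Venture `Summits/Ventures/Crystal3D` (cell `crystal3d-full`); helper for the crux `CoaxialWallLaw`
(stmt-Ventures-19481) in its role as owner of lane T's debt T-F2 / F_layer (cf-p1 (lxxiii)/(lxxx)/(lxxxiii)).  Census-free, standard
axioms; nothing about the crux is claimed; F-C1 not moved.  Continuation of `…BarlowSiteReadings` (same setting: a site
`q = barlowPos 1 √(2/3) s k i j`, its twelve stacking neighbours occupied (`hnb`), its occupied unit sphere on the stacking (`hX`)):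
at an h-layer BOTH dozens read — `…BarlowSiteReadings` gave the identity dozen `D₊`, here the mirror dozen `D₋ = basalMirror '' D₊`
with the opposite normal.  So walkers of EITHER bilayer frame of a faulted plate glide through its fault layers.

* `barlowSite_add_mirrorUpSlot_not_mem`, `barlowSite_add_mirrorDownSlot_not_mem` — letter mismatch ⇒ the mirror-slot position is empty;
* `isMenuNormal_basalMirror_e₃`;
* **`isTwinReading_mirror_barlowSite_up`** (`s (k−1) = 1`, `s k = −1` ⇒ `IsTwinReading X basalMirror (−e₃) q`),
  **`isTwinReading_mirror_barlowSite_down`** (`s (k−1) = −1`, `s k = 1` ⇒ `IsTwinReading X basalMirror e₃ q`).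
WHAT THIS IS NOT: no walker count, no wall inequality; F-C1 not moved.
-/

noncomputable section

namespace Summit.Ventures.Crystal3D.Theorems

open Summit.Ventures.Crystal3D Finset
open Literature.MathematicalPhysics.StatisticalMechanics (barlowPos barlowStacking fccStacking constHagg IsHaggSeq
  haggLabel haggLabel_succ haggLabel_const basalMirror basalMirror_barlowPos_constHagg basalMirror_apply_coord
  triangularVec₁ triangularVec₂ barlowOffset layerNormal barlowPos_apply_two barlowPos_mem)
open scoped InnerProductSpace

section Site

variable {s : ℤ → ℤ} (hs : IsHaggSeq s) (k i j : ℤ)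

/-- Positivity of the layer spacing. -/
private theorem hB_pos : (0 : ℝ) < Real.sqrt (2 / 3) := Real.sqrt_pos.2 (by norm_num)

variable {X : Finset (EuclideanSpace ℝ (Fin 3))}
  (hX : ∀ x ∈ X, dist (barlowPos 1 (Real.sqrt (2 / 3)) s k i j) x = 1 → x ∈ barlowStacking 1 (Real.sqrt (2 / 3)) s)
  (hnb : ∀ x ∈ barlowStacking 1 (Real.sqrt (2 / 3)) s, dist (barlowPos 1 (Real.sqrt (2 / 3)) s k i j) x = 1 → x ∈ X)

include hs hX hnb

/-! ### Letter mismatch ⇒ the mirror-slot position is empty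

At an h-layer BOTH dozens read: the identity dozen with one normal and the mirror dozen `D₋ = basalMirror '' D₊` with the
opposite normal — so walkers of EITHER bilayer frame of a faulted plate glide through its fault layers. -/

/-- A mirror-slot position BELOW `q` is EMPTY when `s (k−1) = 1`: for an UP slot `w` (so `basalMirror w` points down with label `+1`). -/
theorem barlowSite_add_mirrorUpSlot_not_mem (hsk : s (k - 1) = 1) {w : EuclideanSpace ℝ (Fin 3)} (hw : w ∈ fccSlots)
    (hup : 0 < w 2) : barlowPos 1 (Real.sqrt (2 / 3)) s k i j + basalMirror w ∉ X := by
  classical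
  have _ := hnb
  intro hmem
  have hw1 : ‖basalMirror w‖ = 1 := by rw [LinearIsometryEquiv.norm_map, norm_eq_one_of_mem_fccSlots hw]
  have hd : dist (barlowPos 1 (Real.sqrt (2 / 3)) s k i j) (barlowPos 1 (Real.sqrt (2 / 3)) s k i j + basalMirror w) = 1 := by
    rw [dist_eq_norm, sub_add_cancel_left, norm_neg, hw1]
  obtain ⟨k', i', j', hk'⟩ := hX _ hmem hd
  obtain ⟨c, hc, rfl⟩ := mem_image.1 hw
  have hc1 : c.1 = 1 := by
    have h2 := slot_apply_two_eq c
    rcases fccSlotTriples_fst hc with h | h | h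
    · rw [h2, h] at hup; have := hB_pos; push_cast at hup; nlinarith
    · rw [h2, h] at hup; simp at hup
    · exact h
  have hM2 : (basalMirror (barlowPos 1 (Real.sqrt (2 / 3)) constHagg c.1 c.2.1 c.2.2)) 2 = -Real.sqrt (2 / 3) := by
    rw [basalMirror_apply_coord, if_pos rfl, slot_apply_two_eq, hc1]; push_cast; ring
  have hlay : k' = k - 1 := by
    have h := congrArg (fun x : EuclideanSpace ℝ (Fin 3) => x 2) hk'
    simp only [PiLp.add_apply, barlowPos_apply_two, hM2] at h
    have : ((k : ℝ) - 1) * Real.sqrt (2 / 3) = (k' : ℝ) * Real.sqrt (2 / 3) := by linarith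
    have := mul_right_cancel₀ hB_pos.ne' this
    have : (k' : ℤ) = k - 1 := by exact_mod_cast this.symm
    exact this
  subst hlay
  have hd' : dist (barlowPos 1 (Real.sqrt (2 / 3)) s k i j) (barlowPos 1 (Real.sqrt (2 / 3)) s (k - 1) i' j') = 1 := by
    rw [← hk']; exact hd
  rcases neighbour_down_mem hs k i j i' j' hd' with ⟨-, hslot⟩ | ⟨h1, -, -⟩
  · rw [← hk', add_sub_cancel_left] at hslot
    exact not_mem_fccSlots_of_offPlane_image (Set.mem_image_of_mem _ (mem_coe.2 hw)) (by rw [hM2]; have := hB_pos; linarith) hslot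
  · rw [hsk] at h1; norm_num at h1

/-- A mirror-slot position ABOVE `q` is EMPTY when `s k = 1`: for a DOWN slot `w` (so `basalMirror w` points up with label `−1`). -/
theorem barlowSite_add_mirrorDownSlot_not_mem (hsk : s k = 1) {w : EuclideanSpace ℝ (Fin 3)} (hw : w ∈ fccSlots)
    (hdown : w 2 < 0) : barlowPos 1 (Real.sqrt (2 / 3)) s k i j + basalMirror w ∉ X := by
  classical
  have _ := hnb
  intro hmem
  have hw1 : ‖basalMirror w‖ = 1 := by rw [LinearIsometryEquiv.norm_map, norm_eq_one_of_mem_fccSlots hw]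
  have hd : dist (barlowPos 1 (Real.sqrt (2 / 3)) s k i j) (barlowPos 1 (Real.sqrt (2 / 3)) s k i j + basalMirror w) = 1 := by
    rw [dist_eq_norm, sub_add_cancel_left, norm_neg, hw1]
  obtain ⟨k', i', j', hk'⟩ := hX _ hmem hd
  obtain ⟨c, hc, rfl⟩ := mem_image.1 hw
  have hc1 : c.1 = -1 := by
    have h2 := slot_apply_two_eq c
    rcases fccSlotTriples_fst hc with h | h | h
    · exact h
    · rw [h2, h] at hdown; simp at hdown
    · rw [h2, h] at hdown; have := hB_pos; push_cast at hdown; nlinarith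
  have hM2 : (basalMirror (barlowPos 1 (Real.sqrt (2 / 3)) constHagg c.1 c.2.1 c.2.2)) 2 = Real.sqrt (2 / 3) := by
    rw [basalMirror_apply_coord, if_pos rfl, slot_apply_two_eq, hc1]; push_cast; ring
  have hlay : k' = k + 1 := by
    have h := congrArg (fun x : EuclideanSpace ℝ (Fin 3) => x 2) hk'
    simp only [PiLp.add_apply, barlowPos_apply_two, hM2] at h
    have : ((k : ℝ) + 1) * Real.sqrt (2 / 3) = (k' : ℝ) * Real.sqrt (2 / 3) := by linarith
    have := mul_right_cancel₀ hB_pos.ne' this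
    exact_mod_cast this.symm
  subst hlay
  have hd' : dist (barlowPos 1 (Real.sqrt (2 / 3)) s k i j) (barlowPos 1 (Real.sqrt (2 / 3)) s (k + 1) i' j') = 1 := by
    rw [← hk']; exact hd
  rcases neighbour_up_mem hs k i j i' j' hd' with ⟨-, hslot⟩ | ⟨h1, -, -⟩
  · rw [← hk', add_sub_cancel_left] at hslot
    exact not_mem_fccSlots_of_offPlane_image (Set.mem_image_of_mem _ (mem_coe.2 hw)) (by rw [hM2]; exact hB_pos.ne') hslot
  · rw [hsk] at h1; norm_num at h1

/-- The mirror frame with normal `±e₃` is a menu normal pair. -/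
theorem isMenuNormal_basalMirror_e₃ (ε : ℝ) (hε : ε = 1 ∨ ε = -1) :
    IsMenuNormal basalMirror (ε • EuclideanSpace.single (2 : Fin 3) (1 : ℝ)) := by
  have _ := hs; have _ := hnb; have _ := hX
  refine ⟨?_, fun w hw => ?_⟩
  · rw [norm_smul, PiLp.norm_single, norm_one, mul_one]
    rcases hε with rfl | rfl <;> simp
  · rw [inner_smul_right, ← apply_two_eq_inner_e₃, basalMirror_apply_coord, if_pos rfl]
    rcases slot_apply_two_cases hw with h | h | h <;> rcases hε with rfl | rfl <;> rw [h] <;> norm_num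

/-- **h-LAYER `(+, −)` read by the MIRROR dozen: TWIN with normal `−e₃`** (`s (k−1) = 1`, `s k = −1`). -/
theorem isTwinReading_mirror_barlowSite_up (h₁ : s (k - 1) = 1) (h₂ : s k = -1) :
    IsTwinReading X basalMirror (-EuclideanSpace.single (2 : Fin 3) (1 : ℝ)) (barlowPos 1 (Real.sqrt (2 / 3)) s k i j) := by
  classical
  have hmenu := isMenuNormal_basalMirror_e₃ hs k i j hX hnb (-1) (Or.inr rfl)
  rw [neg_one_smul] at hmenu
  have hM2 : ∀ w : EuclideanSpace ℝ (Fin 3), ⟪basalMirror w, -EuclideanSpace.single (2 : Fin 3) (1 : ℝ)⟫_ℝ = w 2 := by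
    intro w; rw [inner_neg_right, ← apply_two_eq_inner_e₃, basalMirror_apply_coord, if_pos rfl, neg_neg]
  refine ⟨hmenu, fun w hw hle => ?_, fun w hw hlt => ?_, fun w hw hpos => ?_⟩
  · -- lower closed half (w₂ ≤ 0): in-plane, or down slots mirrored UP with label −1 (sites by `s k = −1`)
    rw [hM2] at hle
    obtain ⟨c, hc, rfl⟩ := mem_image.1 hw
    refine barlowSite_step_mem_X k i j hnb (by rw [LinearIsometryEquiv.norm_map, norm_eq_one_of_mem_fccSlots hw])
      (barlowSite_add_mirrorSlot_mem k i j hc ?_)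
    rcases fccSlotTriples_fst hc with h | h | h
    · exact Or.inr (Or.inl ⟨h, h₂⟩)
    · exact Or.inl h
    · exfalso; rw [slot_apply_two_eq, h] at hle; have := hB_pos; push_cast at hle; linarith
  · -- mirror balls: `basalMirror w − 2⟪basalMirror w, −e₃⟫(−e₃) = w`, a DOWN slot, site by `s (k−1) = 1`
    have hmir : basalMirror w - (2 * ⟪basalMirror w, -EuclideanSpace.single (2 : Fin 3) (1 : ℝ)⟫_ℝ) •
        -EuclideanSpace.single (2 : Fin 3) (1 : ℝ) = w := by
      rw [basalMirror_apply_eq, inner_sub_left, inner_smul_left, inner_neg_right, inner_neg_right,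
        real_inner_self_eq_norm_sq, PiLp.norm_single, norm_one]
      simp only [one_pow, conj_trivial]
      module
    rw [hmir]
    rw [hM2] at hlt
    obtain ⟨c, hc, rfl⟩ := mem_image.1 hw
    refine barlowSite_step_mem_X k i j hnb (norm_eq_one_of_mem_fccSlots hw) (barlowSite_add_slot_mem k i j hc ?_)
    rcases fccSlotTriples_fst hc with h | h | h
    · exact Or.inr (Or.inr ⟨h, h₁⟩)
    · exfalso; rw [slot_apply_two_eq, h] at hlt; simp at hlt
    · exfalso; rw [slot_apply_two_eq, h] at hlt; have := hB_pos; push_cast at hlt; linarith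
  · -- far slots (w₂ > 0): `basalMirror w` points down with label +1 — empty by `s (k−1) = 1`
    rw [hM2] at hpos
    exact barlowSite_add_mirrorUpSlot_not_mem hs k i j hX hnb h₁ hw hpos

/-- **h-LAYER `(−, +)` read by the MIRROR dozen: TWIN with normal `e₃`** (`s (k−1) = −1`, `s k = 1`). -/
theorem isTwinReading_mirror_barlowSite_down (h₁ : s (k - 1) = -1) (h₂ : s k = 1) :
    IsTwinReading X basalMirror (EuclideanSpace.single (2 : Fin 3) (1 : ℝ)) (barlowPos 1 (Real.sqrt (2 / 3)) s k i j) := by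
  classical
  have hmenu := isMenuNormal_basalMirror_e₃ hs k i j hX hnb 1 (Or.inl rfl)
  rw [one_smul] at hmenu
  have hM2 : ∀ w : EuclideanSpace ℝ (Fin 3), ⟪basalMirror w, EuclideanSpace.single (2 : Fin 3) (1 : ℝ)⟫_ℝ = -w 2 := by
    intro w; rw [← apply_two_eq_inner_e₃, basalMirror_apply_coord, if_pos rfl]
  refine ⟨hmenu, fun w hw hle => ?_, fun w hw hlt => ?_, fun w hw hpos => ?_⟩
  · -- lower closed half (w₂ ≥ 0): in-plane, or up slots mirrored DOWN with label +1 (sites by `s (k−1) = −1`)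
    rw [hM2] at hle
    obtain ⟨c, hc, rfl⟩ := mem_image.1 hw
    refine barlowSite_step_mem_X k i j hnb (by rw [LinearIsometryEquiv.norm_map, norm_eq_one_of_mem_fccSlots hw])
      (barlowSite_add_mirrorSlot_mem k i j hc ?_)
    rcases fccSlotTriples_fst hc with h | h | h
    · exfalso; rw [slot_apply_two_eq, h] at hle; have := hB_pos; push_cast at hle; linarith
    · exact Or.inl h
    · exact Or.inr (Or.inr ⟨h, h₁⟩)
  · -- mirror balls: `basalMirror w − 2⟪basalMirror w, e₃⟫e₃ = w`, an UP slot, site by `s k = 1`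
    have hmir : basalMirror w - (2 * ⟪basalMirror w, EuclideanSpace.single (2 : Fin 3) (1 : ℝ)⟫_ℝ) •
        EuclideanSpace.single (2 : Fin 3) (1 : ℝ) = w := by
      rw [basalMirror_apply_eq, inner_sub_left, inner_smul_left, real_inner_self_eq_norm_sq, PiLp.norm_single, norm_one]
      simp only [one_pow, mul_one, conj_trivial]
      module
    rw [hmir]
    rw [hM2] at hlt
    obtain ⟨c, hc, rfl⟩ := mem_image.1 hw
    refine barlowSite_step_mem_X k i j hnb (norm_eq_one_of_mem_fccSlots hw) (barlowSite_add_slot_mem k i j hc ?_)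
    rcases fccSlotTriples_fst hc with h | h | h
    · exfalso; rw [slot_apply_two_eq, h] at hlt; have := hB_pos; push_cast at hlt; linarith
    · exfalso; rw [slot_apply_two_eq, h] at hlt; simp at hlt
    · exact Or.inr (Or.inl ⟨h, h₂⟩)
  · -- far slots (w₂ < 0): `basalMirror w` points up with label −1 — empty by `s k = 1`
    rw [hM2] at hpos
    exact barlowSite_add_mirrorDownSlot_not_mem hs k i j hX hnb h₂ hw (by linarith)

end Site

end Summit.Ventures.Crystal3D.Theorems

end
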